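import Mathlib.Data.Complex.Basic
import Mathlib.Data.Set.Finite.Basic
import Mathlib.Tactic.Ring
import Mathlib.Tactic.Linarith
import Literature.NumberTheory.LFunctions.MultiplicativeAutomatic
import HarnessLib

/-!
# Closure properties of automatic sequences in the kernel formulation (proved)

Everything in this file is PROVED. For the tree's kernel definition
`Literature.NumberTheory.LFunctions.IsAutomaticSeq k a` (finite `k`-kernel,
`MultiplicativeAutomatic.lean`) we prove the closure properties of `k`-automatic sequences that
C. Müllner, *Automatic sequences fulfill the Sarnak conjecture* (Duke Math. J. 166 (2017)),
Lemma 3.1, quotes from Allouche–Shallit to pass from the sequence `a` to the observables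
`g(b_{n+r}, …, b_{n+r+j-1})` of its subshift: images under binary maps (`IsAutomaticSeq.map₂`,
hence sums and products), shifts `n ↦ a(n + r)` (`IsAutomaticSeq.shift`), and more generally
linear subsequences `n ↦ a(m n + r)` (`IsAutomaticSeq.linearSubseq`, Allouche–Shallit Thm. 6.8.1),
all by exhibiting a finite set containing the kernel of the new sequence.

## References
* J.-P. Allouche, J. Shallit, *Automatic Sequences*, CUP 2003, Thm. 5.4.4 / Cor. 5.4.5 (products),
  Thm. 6.8.1 (linear subsequences `a(mn + r)`). [AlloucheShallit2003]
* C. Müllner, Duke Math. J. 166 (2017), Lemma 3.1. [Mullner2017]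
-/

namespace Literature.NumberTheory.LFunctions

/-- The sequences `(a(k^i n + r))_n` (`i ≥ 1`, `r < k^i`) belong to the `k`-kernel of `a`. [folklore] -/
theorem mem_qKernel {k : ℕ} {a : ℕ → ℂ} {i r : ℕ} (hi : 1 ≤ i) (hr : r < k ^ i) :
    (fun n => a (k ^ i * n + r)) ∈ qKernel k a :=
  ⟨i, hi, r, hr, rfl⟩

/-- **Images under binary maps**: if `a, b` are `k`-automatic then so is `n ↦ Φ (a n) (b n)`
(the kernel of the image is contained in the image of `K_k(a) × K_k(b)`; Allouche–Shallit
Cor. 5.4.5 for products). [cite: AlloucheShallit2003, Thm. 5.4.4] -/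
theorem IsAutomaticSeq.map₂ {k : ℕ} {a b : ℕ → ℂ} (ha : IsAutomaticSeq k a)
    (hb : IsAutomaticSeq k b) (Φ : ℂ → ℂ → ℂ) :
    IsAutomaticSeq k (fun n => Φ (a n) (b n)) := by
  refine ((ha.prod hb).image fun p : (ℕ → ℂ) × (ℕ → ℂ) => fun n => Φ (p.1 n) (p.2 n)).subset ?_
  rintro g ⟨i, hi, r, hr, rfl⟩
  exact ⟨(fun n => a (k ^ i * n + r), fun n => b (k ^ i * n + r)),
    ⟨mem_qKernel hi hr, mem_qKernel hi hr⟩, rfl⟩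

/-- Products of `k`-automatic sequences are `k`-automatic. [cite: AlloucheShallit2003, Cor. 5.4.5] -/
theorem IsAutomaticSeq.mul {k : ℕ} {a b : ℕ → ℂ} (ha : IsAutomaticSeq k a)
    (hb : IsAutomaticSeq k b) : IsAutomaticSeq k (fun n => a n * b n) :=
  ha.map₂ hb (· * ·)

/-- Sums of `k`-automatic sequences are `k`-automatic. [cite: AlloucheShallit2003, Cor. 5.4.5] -/
theorem IsAutomaticSeq.add {k : ℕ} {a b : ℕ → ℂ} (ha : IsAutomaticSeq k a)
    (hb : IsAutomaticSeq k b) : IsAutomaticSeq k (fun n => a n + b n) :=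
  ha.map₂ hb (· + ·)

/-- **Shift by one**: if `a` is `k`-automatic then so is `n ↦ a (n + 1)`; the kernel of the shift
lies in `K_k(a) ∪ S(K_k(a))` (`S` the shift), since `a(k^i n + r + 1)` is a kernel element for
`r + 1 < k^i` and is `S` of the kernel element `(a(k^i n))_n` for `r + 1 = k^i`.
[cite: AlloucheShallit2003, Thm. 6.8.1] -/
theorem IsAutomaticSeq.shift_one {k : ℕ} {a : ℕ → ℂ} (ha : IsAutomaticSeq k a) :
    IsAutomaticSeq k (fun n => a (n + 1)) := by
  refine (ha.union (ha.image fun g : ℕ → ℂ => fun n => g (n + 1))).subset ?_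
  rintro g ⟨i, hi, r, hr, rfl⟩
  rcases lt_or_eq_of_le (Nat.succ_le_of_lt hr) with h | h
  · left
    refine ⟨i, hi, r + 1, h, ?_⟩
    funext n
    simp only [add_assoc]
  · right
    refine ⟨fun n => a (k ^ i * n + 0), mem_qKernel hi (by omega), ?_⟩
    funext n
    simp only [add_zero]
    congr 1
    rw [mul_add, mul_one, ← h, add_assoc]

/-- **Shifts**: if `a` is `k`-automatic then so is `n ↦ a (n + r)` for every `r` (Müllner,
Lemma 3.1: "`(b_{n+ℓ})_{n∈ℕ}` is again an automatic sequence"). [cite: Mullner2017, Lemma 3.1] -/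
theorem IsAutomaticSeq.shift {k : ℕ} {a : ℕ → ℂ} (ha : IsAutomaticSeq k a) (r : ℕ) :
    IsAutomaticSeq k (fun n => a (n + r)) := by
  induction r with
  | zero => simpa using ha
  | succ r ih => simpa [add_assoc, add_comm r 1] using ih.shift_one

/-- **Linear subsequences** (Allouche–Shallit, Thm. 6.8.1): if `a` is `k`-automatic then so is
`n ↦ a (m n + r)` for all `m, r`; the kernel element `(a(m(k^i n + s) + r))_n` is
`(g(m n + u))_n` for the kernel element `g = (a(k^i n + v))_n` of `a`, where
`m s + r = k^i u + v`, `v < k^i`, `u ≤ m + r`. [cite: AlloucheShallit2003, Thm. 6.8.1] -/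
theorem IsAutomaticSeq.linearSubseq {k : ℕ} {a : ℕ → ℂ} (ha : IsAutomaticSeq k a) (m r : ℕ) :
    IsAutomaticSeq k (fun n => a (m * n + r)) := by
  let F : (ℕ → ℂ) × ℕ → (ℕ → ℂ) := fun p n => p.1 (m * n + p.2)
  refine ((ha.prod (Set.finite_Iio (m + r + 1))).image F).subset ?_
  rintro g ⟨i, hi, s, hs, rfl⟩
  have hKpos : 0 < k ^ i := by
    rcases Nat.eq_zero_or_pos (k ^ i) with h | h
    · omega
    · exact h
  -- `u = (m s + r) / k^i ≤ m + r`
  have hule : (m * s + r) / k ^ i < m + r + 1 := by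
    rw [Nat.div_lt_iff_lt_mul hKpos]
    have h4 : m * s + m ≤ m * k ^ i := by
      have := Nat.mul_le_mul_left m (Nat.succ_le_of_lt hs)
      rwa [Nat.mul_succ] at this
    have h7 : r ≤ r * k ^ i := Nat.le_mul_of_pos_right _ hKpos
    calc m * s + r < m * s + m + r * k ^ i + k ^ i := by omega
      _ ≤ m * k ^ i + r * k ^ i + k ^ i := by omega
      _ = (m + r + 1) * k ^ i := by ring
  have hdm : k ^ i * ((m * s + r) / k ^ i) + (m * s + r) % k ^ i = m * s + r := Nat.div_add_mod _ _
  have hvlt : (m * s + r) % k ^ i < k ^ i := Nat.mod_lt _ hKpos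
  generalize (m * s + r) / k ^ i = u at hdm hule
  generalize (m * s + r) % k ^ i = v at hdm hvlt
  refine ⟨(fun n => a (k ^ i * n + v), u), ⟨mem_qKernel hi hvlt, hule⟩, ?_⟩
  funext n
  simp only [F]
  congr 1
  calc k ^ i * (m * n + u) + v = k ^ i * (m * n) + (k ^ i * u + v) := by ring
    _ = k ^ i * (m * n) + (m * s + r) := by rw [hdm]
    _ = m * (k ^ i * n + s) + r := by ring

end Literature.NumberTheory.LFunctions
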